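import Summits.QuantumFields.YangMills.Theorems.BalabanUVNodesN11FluctTruncation
import Summits.QuantumFields.YangMills.Theorems.BalabanUVNodesN11NoExpansionOldBranchGraph

/-!
# DAG node N11 — THE OFF-DIAGONAL RESIDUE OF THE NO-EXPANSION 𝐓-STEP IS {hIB}: doors (d1) (fluctuation truncation, `…N11FluctTruncation`) and (d2) (joint law
# carried by the averaging graph, `…N11NoExpansionOldBranchGraph`) COMBINED — per witness and witness-first, the one remaining binder is the `dU_k`-integrability
# of the old branches of the `SLaw` witness

HEADER — WORK-UNIT METADATA.  Cell `pub-ymgap`, YM-PLAN Track A (HUMAN RULING D-0062), seat `pub-ymgap-dag-n11-d` (g10; R134 fan-out seat N11 [B14], strategy s2),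
route `BalabanUVNodes` rev 25, item K1⁷ `StabilityBAtRecordR13SepCoPH` = stmt-QuantumFields-20542 (helper, `--kind proof --supports 20542 --as helper`, count-neutral).
[III] = [Balaban1988Convergent].  Over this seat's g10 files `…N11FluctTruncationDefs`∕`…N11FluctTruncation` (p572365 ∕ p573517: `truncTermValues`, `IsFluctLocal`,
`sect2Slot_truncTermValues`, `sLaw₁₃CoPH_iff_exists_local`) and `…N11NoExpansionOldBranchGraph` (`clause_succ_rePinH_of_Omega_empty_of_oldBranch_of_clause_of_graph`).

WHY THIS FILE.  Referee READ-733 on p569094: residue {hA, hΦm, hIB}.  (d1) removed hA per witness (truncation), (d2) removed hΦm∕hmB (graph).  This file states the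
three per-witness faces of `…N11FluctTruncation` §4 on the graph edition, so that their ONLY displayed analytic binder is `hIB` — the currency the R-side seat
(dag-n11-e g14) asked to consume in ONE round.

WHAT THIS FILE PROVES (0 `sorry`, 0 `def`; 3 thm).  `clause_succ_rePinH_of_Omega_empty_of_isFluctLocal_of_clause_of_graph` (k-local witness: `hid` + `hIB` ⇒ clause) ·
★★★ `clause_succ_rePinH_truncTermValues_of_Omega_empty_of_clause_of_graph` (ANY `t`: `hid` for `t` + `hIB` for `truncTermValues k t` ⇒ clause for `truncTermValues k t`) ·
★★★ `exists_local_witness_clause_succ_rePinH_of_sLaw₁₃CoPH_of_graph` (`SLaw`-keyed, WITNESS FIRST: ∃ law-abiding k-local `(t, E_k)` with the level-k dichotomy, and for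
every no-expansion history `s′`, `hIB` OF THAT WITNESS ⇒ the 𝐓-image clause at `s′`).

HONEST FRAMING.  Helper lane of K1⁷; composition of accepted kernel bookkeeping; nothing of Bałaban's is asserted; no binder quantifies over all term families.
`hIB` holds on the all-large diagonal (p563687); off it, it is a property of the §2 witness AND the 𝐓-weights of record (the inner generations' fluctuation integrals),
for node00-def-T∕K0b — a structural sufficient condition (operand measurable and bounded, A-fibre weights dominated by an integrable function of the integrated
variables, `ζ ≤ 1`) is this seat's next file.  N11 NOT discharged; K1⁷ NOT closed; counts unmoved (typed 28∕28 · discharged 5∕27).  One finite four-torus programme at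
fixed `ε = L^{−K}` — NOT ℝ⁴, NOT OS, NOT a mass gap, NOT Clay.  No `sorry`, `axiom`, `instance`, `notation`.
Sources (SHAPE only): [III] Theorem p.245, (2.18) p.257, (2.23) p.258, (2.40)–(2.41) p.261, Thm 1 p.262, (3.24)–(3.25) p.270.
-/

noncomputable section

open MeasureTheory
open scoped BigOperators Matrix.Norms.L2Operator

namespace Summit.QuantumFields.YangMills.Theorems.BalabanUVNodesN11FluctTruncationGraph

open Literature.MathematicalPhysics.QuantumFieldTheory.Balaban1983to89 T4Continuum Node00 Node00.Tk DagBinding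
open B15DeterminingSets
open BalabanUVNodesN11FluctTruncationDefs BalabanUVNodesN11RePinnedParamDefs
open BalabanUVNodesN11FluctTruncation (sect2Slot_truncTermValues sLaw₁₃CoPH_iff_exists_local)
open BalabanUVNodesN11NoExpansionOldBranchGraph (clause_succ_rePinH_of_Omega_empty_of_oldBranch_of_clause_of_graph)

variable {F : T4Family} {N : ℕ} [NeZero N]

section RePinned

variable (θ : Stage13HParams F N) (p : B12.RunParams)

/-- **THE GENERAL-HISTORY NO-EXPANSION 𝐓-STEP AT `rePinH θ` FOR A `k`-LOCAL WITNESS UNDER INTEGRABILITY OF ITS OLD BRANCHES ALONE** (`…N11FluctTruncation`'s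
`clause_succ_rePinH_of_Omega_empty_of_isFluctLocal_of_clause_of_integrable` with `hmB` DROPPED, over `…N11NoExpansionOldBranchGraph`). [cite: Balaban1988Convergent, Theorem p.245, (3.24)–(3.25) p.270, (2.23) p.258, (2.40)–(2.41) p.261] -/
theorem clause_succ_rePinH_of_Omega_empty_of_isFluctLocal_of_clause_of_graph (h : θ.Provisos₁₃CoPH F N) {k : ℕ} (hk : k < p.K) (hM : 1 ≤ θ.τ9.M)
    (s : SeqOfRecord F θ.ν θ.τ9.M (gOfRecord₁₃ F N θ.toStage13Params p) p.K (k + 1)) (hΩ : s.Ω (k + 1) = ∅)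
    (t : Sect2.TermValues (F.P p.K) (MatA N) (FluctV N) θ.τ9.M) (ht : IsFluctLocal k t) (E₀ : ℝ)
    (hid : slotsOfRecord F N θ.ν θ.τ9 (EOfRecord₁₃ F N θ.toStage13Params) (wOfRecord₉ F N θ.toStage9Params) θ.ppSel p
        (gOfRecord₁₃ F N θ.toStage13Params p) k s.init = 0 ∨
      ∀ᵐ U₀ ∂fieldMeasure (F.P p.K) k (SU N),
        chiSeqOfRecord F N θ.ν θ.τ9.M (gOfRecord₁₃ F N θ.toStage13Params p) p.K k s.init U₀ ≠ 0 →
          slotsOfRecord F N θ.ν θ.τ9 (EOfRecord₁₃ F N θ.toStage13Params) (wOfRecord₉ F N θ.toStage9Params) θ.ppSel p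
              (gOfRecord₁₃ F N θ.toStage13Params p) k s.init U₀ =
            sect2Slot F N (FluctV N) p.K (settingOfRecord₁₃ F N θ.toStage13Params p) (θ.rzAt p s.init) (WtOfRecord₁₃H F N (rePinH θ) p s.init) s.init t E₀
              (UbgOfRecord₁₃CoP F N θ.toStage13Params p k s.init) U₀)
    (hIB : ∀ S ∈ admSOfRecord F θ.ν θ.τ9.M (gOfRecord₁₃ F N θ.toStage13Params p) p.K k s.init,
      Integrable (fun U₀ : GaugeField (F.P p.K) k (SU N) =>
        tkBranchOfRecord F N (FluctV N) θ.ν θ.τ9.M _ p.K (WtOfRecord₁₃H F N (rePinH θ) p s) s.init S k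
          (fun ω => sect2Operand F N (FluctV N) p.K (settingOfRecord₁₃ F N θ.toStage13Params p) (θ.rzAt p s.init) s.init t E₀
            (UbgOfRecord₁₃CoP F N θ.toStage13Params p k s.init) (S, fun j => (ω j).2) (fun j => (ω j).1))
          (baseCfg (V := FluctV N) k U₀)) (fieldMeasure (F.P p.K) k (SU N))) :
    slotsTOfRecord F N θ.ν θ.τ9 (EOfRecord₁₃ F N θ.toStage13Params) (wOfRecord₉ F N θ.toStage9Params) θ.ppSel p
        (gOfRecord₁₃ F N θ.toStage13Params p) (k + 1) s = 0 ∨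
      ∀ᵐ V' ∂fieldMeasure (F.P p.K) (k + 1) (SU N),
        chiSeqOfRecord F N θ.ν θ.τ9.M (gOfRecord₁₃ F N θ.toStage13Params p) p.K (k + 1) s V' ≠ 0 →
          slotsTOfRecord F N θ.ν θ.τ9 (EOfRecord₁₃ F N θ.toStage13Params) (wOfRecord₉ F N θ.toStage9Params) θ.ppSel p
              (gOfRecord₁₃ F N θ.toStage13Params p) (k + 1) s V' =
            sect2Slot F N (FluctV N) p.K (settingOfRecord₁₃ F N θ.toStage13Params p) (θ.rzAt p s) (WtOfRecord₁₃H F N (rePinH θ) p s) s t E₀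
              (UbgOfRecord₁₃CoP F N θ.toStage13Params p (k + 1) s) V' :=
  clause_succ_rePinH_of_Omega_empty_of_oldBranch_of_clause_of_graph θ p h hk hM s hΩ t E₀
    (fun S a a' Uf ha => action23_sect2ActionDataOfRecord_congr_fluct_of_isFluctLocal p.K _ _ s.init ht E₀ S a a' ha Uf) hid hIB

/-- **★★★ THE GENERAL-HISTORY NO-EXPANSION 𝐓-STEP AT `rePinH θ` WITH NO LOCALITY BINDER, PER WITNESS**: for ANY term values `t` and constant `E₀` carrying the level-`k`
§2 identity at `init s′` (`hid`, for `t` itself), the 𝐓-image clause at `s′` holds for the TRUNCATED family `truncTermValues k t` — provided the old branches OF THAT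
FAMILY are `dU_k`-integrable.  (hA) of p569094 is gone: the identity transfers to the truncated family by `sect2Slot_truncTermValues` (nothing `𝐓_k`
reads changes) and the truncated family is `k`-local by construction.  No binder quantifies over all term families. [cite: Balaban1988Convergent, Theorem p.245, Thm 1 p.262, (3.24)–(3.25) p.270, (2.23) p.258, (2.40)–(2.41) p.261] -/
theorem clause_succ_rePinH_truncTermValues_of_Omega_empty_of_clause_of_graph (h : θ.Provisos₁₃CoPH F N) {k : ℕ} (hk : k < p.K) (hM : 1 ≤ θ.τ9.M)
    (s : SeqOfRecord F θ.ν θ.τ9.M (gOfRecord₁₃ F N θ.toStage13Params p) p.K (k + 1)) (hΩ : s.Ω (k + 1) = ∅)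
    (t : Sect2.TermValues (F.P p.K) (MatA N) (FluctV N) θ.τ9.M) (E₀ : ℝ)
    (hid : slotsOfRecord F N θ.ν θ.τ9 (EOfRecord₁₃ F N θ.toStage13Params) (wOfRecord₉ F N θ.toStage9Params) θ.ppSel p
        (gOfRecord₁₃ F N θ.toStage13Params p) k s.init = 0 ∨
      ∀ᵐ U₀ ∂fieldMeasure (F.P p.K) k (SU N),
        chiSeqOfRecord F N θ.ν θ.τ9.M (gOfRecord₁₃ F N θ.toStage13Params p) p.K k s.init U₀ ≠ 0 →
          slotsOfRecord F N θ.ν θ.τ9 (EOfRecord₁₃ F N θ.toStage13Params) (wOfRecord₉ F N θ.toStage9Params) θ.ppSel p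
              (gOfRecord₁₃ F N θ.toStage13Params p) k s.init U₀ =
            sect2Slot F N (FluctV N) p.K (settingOfRecord₁₃ F N θ.toStage13Params p) (θ.rzAt p s.init) (WtOfRecord₁₃H F N (rePinH θ) p s.init) s.init t E₀
              (UbgOfRecord₁₃CoP F N θ.toStage13Params p k s.init) U₀)
    (hIB : ∀ S ∈ admSOfRecord F θ.ν θ.τ9.M (gOfRecord₁₃ F N θ.toStage13Params p) p.K k s.init,
      Integrable (fun U₀ : GaugeField (F.P p.K) k (SU N) =>
        tkBranchOfRecord F N (FluctV N) θ.ν θ.τ9.M _ p.K (WtOfRecord₁₃H F N (rePinH θ) p s) s.init S k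
          (fun ω => sect2Operand F N (FluctV N) p.K (settingOfRecord₁₃ F N θ.toStage13Params p) (θ.rzAt p s.init) s.init (truncTermValues k t) E₀
            (UbgOfRecord₁₃CoP F N θ.toStage13Params p k s.init) (S, fun j => (ω j).2) (fun j => (ω j).1))
          (baseCfg (V := FluctV N) k U₀)) (fieldMeasure (F.P p.K) k (SU N))) :
    slotsTOfRecord F N θ.ν θ.τ9 (EOfRecord₁₃ F N θ.toStage13Params) (wOfRecord₉ F N θ.toStage9Params) θ.ppSel p
        (gOfRecord₁₃ F N θ.toStage13Params p) (k + 1) s = 0 ∨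
      ∀ᵐ V' ∂fieldMeasure (F.P p.K) (k + 1) (SU N),
        chiSeqOfRecord F N θ.ν θ.τ9.M (gOfRecord₁₃ F N θ.toStage13Params p) p.K (k + 1) s V' ≠ 0 →
          slotsTOfRecord F N θ.ν θ.τ9 (EOfRecord₁₃ F N θ.toStage13Params) (wOfRecord₉ F N θ.toStage9Params) θ.ppSel p
              (gOfRecord₁₃ F N θ.toStage13Params p) (k + 1) s V' =
            sect2Slot F N (FluctV N) p.K (settingOfRecord₁₃ F N θ.toStage13Params p) (θ.rzAt p s) (WtOfRecord₁₃H F N (rePinH θ) p s) s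
              (truncTermValues k t) E₀ (UbgOfRecord₁₃CoP F N θ.toStage13Params p (k + 1) s) V' := by
  refine clause_succ_rePinH_of_Omega_empty_of_isFluctLocal_of_clause_of_graph θ p h hk hM s hΩ (truncTermValues k t)
    (isFluctLocal_truncTermValues k t) E₀ ?_ hIB
  rw [sect2Slot_truncTermValues p.K _ _ _ (Nat.le_succ k)]
  exact hid

/-- **★★★ THE OFF-DIAGONAL RESIDUE OF N11's NO-EXPANSION 𝐓-STEP, `SLaw`-KEYED, (hA) ELIMINATED, WITNESS FIRST**: from `SLaw₁₃CoPH (rePinH θ) p k` one obtains term-value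
and constant FAMILIES `(t, E_k)` — universal in `𝐄`, every member `k`-LOCAL and obeying the inductive laws `Sect2.LawsRT … k` on its own tower, carrying the level-`k`
§2 dichotomy of `ρ_k` at every history — such that for EVERY history `s′` with `Ω_{k+1}(s′) = ∅` the 𝐓-image clause at `s′` holds for `(t (init s′), E_k(init s′))`
as soon as the old branches OF THAT WITNESS are `dU_k`-integrable.  The one remaining binder is a property of the produced witness, stated after it (no
hypothesis quantifies over all term families); it holds on the all-large diagonal (p563687). [cite: Balaban1988Convergent, Theorem p.245, Thm 1 p.262, (3.24)–(3.25) p.270, (2.18) p.257, (2.23) p.258, (2.40)–(2.41) p.261] -/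
theorem exists_local_witness_clause_succ_rePinH_of_sLaw₁₃CoPH_of_graph (h : θ.Provisos₁₃CoPH F N) {k : ℕ} (hk : k < p.K) (hM : 1 ≤ θ.τ9.M)
    (hS : SLaw₁₃CoPH F N (rePinH θ) p k) :
    ∃ (t : SeqOfRecord F θ.ν θ.τ9.M (gOfRecord₁₃ F N θ.toStage13Params p) p.K k → Sect2.TermValues (F.P p.K) (MatA N) (FluctV N) θ.τ9.M)
      (Ek : SeqOfRecord F θ.ν θ.τ9.M (gOfRecord₁₃ F N θ.toStage13Params p) p.K k → ℝ),
      HasSect2FormAtZS F N (FluctV N) p.K (settingOfRecord₁₃ F N θ.toStage13Params p) k (θ.rzAt p) (WtOfRecord₁₃H F N (rePinH θ) p)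
          (UbgOfRecord₁₃CoP F N θ.toStage13Params p k)
          (fun s₀ t₀ => Sect2.LawsRT (sect2TowerOfRecord F N (FluctV N) p.K (settingOfRecord₁₃ F N θ.toStage13Params p) (θ.rzAt p s₀) s₀ t₀)
            (settingOfRecord₁₃ F N θ.toStage13Params p).lf k)
          (slotsOfRecord F N θ.ν θ.τ9 (EOfRecord₁₃ F N θ.toStage13Params) (wOfRecord₉ F N θ.toStage9Params) θ.ppSel p
            (gOfRecord₁₃ F N θ.toStage13Params p) k) t Ek ∧
      (∀ s₀, IsFluctLocal k (t s₀)) ∧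
      ∀ (s : SeqOfRecord F θ.ν θ.τ9.M (gOfRecord₁₃ F N θ.toStage13Params p) p.K (k + 1)), s.Ω (k + 1) = ∅ →
        (∀ S ∈ admSOfRecord F θ.ν θ.τ9.M (gOfRecord₁₃ F N θ.toStage13Params p) p.K k s.init,
          Integrable (fun U₀ : GaugeField (F.P p.K) k (SU N) =>
            tkBranchOfRecord F N (FluctV N) θ.ν θ.τ9.M _ p.K (WtOfRecord₁₃H F N (rePinH θ) p s) s.init S k
              (fun ω => sect2Operand F N (FluctV N) p.K (settingOfRecord₁₃ F N θ.toStage13Params p) (θ.rzAt p s.init) s.init (t s.init) (Ek s.init)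
                (UbgOfRecord₁₃CoP F N θ.toStage13Params p k s.init) (S, fun j => (ω j).2) (fun j => (ω j).1))
              (baseCfg (V := FluctV N) k U₀)) (fieldMeasure (F.P p.K) k (SU N))) →
        (slotsTOfRecord F N θ.ν θ.τ9 (EOfRecord₁₃ F N θ.toStage13Params) (wOfRecord₉ F N θ.toStage9Params) θ.ppSel p
            (gOfRecord₁₃ F N θ.toStage13Params p) (k + 1) s = 0 ∨
          ∀ᵐ V' ∂fieldMeasure (F.P p.K) (k + 1) (SU N),
            chiSeqOfRecord F N θ.ν θ.τ9.M (gOfRecord₁₃ F N θ.toStage13Params p) p.K (k + 1) s V' ≠ 0 →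
              slotsTOfRecord F N θ.ν θ.τ9 (EOfRecord₁₃ F N θ.toStage13Params) (wOfRecord₉ F N θ.toStage9Params) θ.ppSel p
                  (gOfRecord₁₃ F N θ.toStage13Params p) (k + 1) s V' =
                sect2Slot F N (FluctV N) p.K (settingOfRecord₁₃ F N θ.toStage13Params p) (θ.rzAt p s) (WtOfRecord₁₃H F N (rePinH θ) p s) s
                  (t s.init) (Ek s.init) (UbgOfRecord₁₃CoP F N θ.toStage13Params p (k + 1) s) V') := by
  obtain ⟨t, Ek, hform, hloc⟩ := (sLaw₁₃CoPH_iff_exists_local (rePinH θ) p k).1 hS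
  exact ⟨t, Ek, hform, hloc, fun s hΩ hIB =>
    clause_succ_rePinH_of_Omega_empty_of_isFluctLocal_of_clause_of_graph θ p h hk hM s hΩ (t s.init) (hloc s.init) (Ek s.init)
      (hform.2 s.init).2 hIB⟩

end RePinned

end Summit.QuantumFields.YangMills.Theorems.BalabanUVNodesN11FluctTruncationGraph

end
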